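import Summits.BirchSwinnertonDyer.BirchSwinnertonDyer.Theorems.EdixhovenFibreFiveSevenStarredOptimalManinUnitFiveSevenOfTS1
import Literature.NumberTheory.PAdicHodge.TateSenConditionHolds
import HarnessLib

/-!
# Route `EdixhovenFibreFiveSeven`, crux K★ `StarredOptimalManinUnitFiveSeven` (stmt-BirchSwinnertonDyer-22226): the conditional
# closer with the Tate–Sen axiom (TS1) DISCHARGED — K★ ⟸ {P1, hT₂, hDR}

Cell `pub/bsd-wall`, seat `bsd-line-edix-p1` g11 (line `kato-lever`, (TS1) Kummer route). The closers of seat edix-p4 g6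
(`…_of_sl2NeronValues_of_TS1`, file `…OfTS1`) displayed the cite-only Tate–Sen axiom
`Literature.NumberTheory.PAdicHodge.tate1967_TS1_completedAlgClosure` (Tate 1967 §3.2 Prop. 9 / Berger–Colmez Prop. 4.1.1), or
Scholze 2012 Thm. 3.7 (i) through `tate1967_TS1_of_scholze2012`. That axiom is now a TREE THEOREM,
`Literature.NumberTheory.PAdicHodge.tate1967_TS1_completedAlgClosure_holds` (file `TateSenConditionHolds`: the elementary
Kummer route — almost-perfectoid package of `ℚ_p(μ_{p^∞})`, ascent along Kummer / radical / root-of-unity steps, Sylow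
dévissage, and the tame structure theorem for prime-to-`p` extensions of `ℚ_p(μ_{p^∞})`). Hence:

* `KatoAssemblySocket.kato_neron_five_le_of_sl2NeronValues_of_isDeRham (hT₂) (hDR) (hP1) : F″`;
* `starredOptimalManinUnitFiveSeven_of_sl2NeronValues_of_isDeRham (hT₂) (hDR) (hP1) : K★`.

CONDITIONAL RESULT (gate audit `proof.conditional`): P1 (`Kato2004.exists_member_sl2ZetaElement_neron_values`, Kato's
explicit reciprocity law values), hT₂ (`exists_smul_range_expStarCoord_tower_iff_trace_log`, the (S5b)-tower) and hDR
(`isDeRham_restrictedRationalTateRep`) remain cite-only named facts; the item stays OPEN; BSD is not proved by any of this.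
-/

set_option autoImplicit false
-- the Theorems namespace of a single-conjunct summit repeats the summit name by design (D-0017)
set_option linter.dupNamespace false

noncomputable section

namespace Summit.BirchSwinnertonDyer.BirchSwinnertonDyer.Theorems

/-- **F″ ⟸ P1 + (S5b-tower) + de Rham** — Kato's Néron integrality of twisted symbol sums at additive `p ≥ 5`
(`kato_neron_isIntegral_twistedSymbolSum_of_additive_five_le`) with the whole `p`-adic Hodge input (Kato II Prop. 1.2.3,
§1.2.7, Tate–Sen (TS1)) PROVED in the tree: `kato_neron_five_le_of_sl2NeronValues_of_TS1` fed by
`tate1967_TS1_completedAlgClosure_holds`. CONDITIONAL on P1, hT₂, hDR.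
[cite: Kato2004Asterisque, (8.1.3) (p. 180), Thm. 9.7 (p. 189), Thm. 6.6 (1) (p. 163), Thm. 13.6 (p. 227)]
[cite: Kato1993LNM1553, Ch. II Prop. 1.2.3, §1.2.5–1.2.7] [cite: Tate1967, §3.2 Prop. 9, §3.3 Theorems 1–2] -/
theorem KatoAssemblySocket.kato_neron_five_le_of_sl2NeronValues_of_isDeRham
    (hT₂ : Literature.NumberTheory.PAdicHodge.exists_smul_range_expStarCoord_tower_iff_trace_log)
    (hDR : Literature.NumberTheory.PAdicHodge.isDeRham_restrictedRationalTateRep)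
    (hP1 : Literature.NumberTheory.EllipticCurves.Kato2004.exists_member_sl2ZetaElement_neron_values) :
    Literature.NumberTheory.EllipticCurves.kato_neron_isIntegral_twistedSymbolSum_of_additive_five_le :=
  KatoAssemblySocket.kato_neron_five_le_of_sl2NeronValues_of_TS1 hT₂
    Literature.NumberTheory.PAdicHodge.tate1967_TS1_completedAlgClosure_holds hDR hP1

/-- **K★ ⟸ P1 + (S5b-tower) + de Rham** (conditional closer of stmt-BirchSwinnertonDyer-22226 with the Tate–Sen axiom
DISCHARGED): Manin's `p`-part at the lattice-optimal datum of an `X₀(N)`-optimal curve of starred additive type at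
`p ∈ {5, 7}` with `E[p]` irreducible — `starredOptimalManinUnitFiveSeven_of_sl2NeronValues_of_TS1` ∘
`tate1967_TS1_completedAlgClosure_holds`. The `p`-adic Hodge theory under F″ (Tate 1967 §3.2–§3.3, Kato II §1.2) is now
entirely a tree theorem; only Kato's value computation P1, the (S5b)-tower hT₂ and de Rham-ness hDR are assumed.
[cite: Kato2004Asterisque, (8.1.3) (p. 180), Thm. 9.7 (p. 189)] [cite: EdixhovenManin1991, Thm. 3 and §4]
[cite: Tate1967, §3.2 Prop. 9] -/
theorem starredOptimalManinUnitFiveSeven_of_sl2NeronValues_of_isDeRham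
    (hT₂ : Literature.NumberTheory.PAdicHodge.exists_smul_range_expStarCoord_tower_iff_trace_log)
    (hDR : Literature.NumberTheory.PAdicHodge.isDeRham_restrictedRationalTateRep)
    (hP1 : Literature.NumberTheory.EllipticCurves.Kato2004.exists_member_sl2ZetaElement_neron_values) :
    Summit.BirchSwinnertonDyer.BirchSwinnertonDyer.Theses.EdixhovenFibreFiveSeven.StarredOptimalManinUnitFiveSeven :=
  starredOptimalManinUnitFiveSeven_of_sl2NeronValues_of_TS1 hT₂
    Literature.NumberTheory.PAdicHodge.tate1967_TS1_completedAlgClosure_holds hDR hP1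

end Summit.BirchSwinnertonDyer.BirchSwinnertonDyer.Theorems

end
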